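import Mathlib
import HarnessLib
import Literature.Computability.AlgebraicComplexity.PatternExpressions
import Literature.Combinatorics.SimpleGraph.TreeDecomposition
import Summits.ValiantsHypothesis.ValiantsHypothesis.Theorems.MonotoneRestorationMonotoneRestorationQPLinearWidthMomentAlignment
import Summits.ValiantsHypothesis.ValiantsHypothesis.Theorems.MonotoneRestorationMonotoneRestorationQPLinearWidthCaterpillarHom

/-!
# Route MonotoneRestoration, crux `MonotoneRestorationQP` (stmt-15886), line `linear-width` —
# THE WIDTH HYPOTHESIS SATURATES: `Disc(row sums)² · Disc(col sums)² · h` is hom-determined below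
# treewidth 3 for every matrix-symmetric `h`

Helper file (`--supports stmt-ValiantsHypothesis-15886`), def-free.  The registered stub
`stub_degreeLifting : LinearDegreeWidthRestoration → WidthRestorationQP` of
`Cruxes/MonotoneRestorationQP/Lines/linear_width.lean` carries the docstring remark — flagged there as a
"certified remark `…`" but so far WITHOUT a tree proof — that from degree `≈ n²` on the width hypothesis
`PolylogHomDetermined` of the graded family `WidthRung d` holds for free: for every matrix-symmetric `h`,
the product `Disc(row sums)² · Disc(column sums)² · h` is determined by the values of homomorphism
polynomials of patterns of treewidth `< 3` (indeed by stars and double stars), because off the zero locus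
of the two discriminants a point of `ℂ^{n×n}` is determined up to row and column permutations by its
caterpillar moments (`MomentAlignment.exists_perms_of_moments`), and on it both sides vanish.  This file
certifies the remark:

* `moments_of_homIndist` — `HomIndist n k A B` (the line's definition, unfolded verbatim: equal values of
  `homPoly E n ℂ` for all patterns `E` whose pattern graph has treewidth `< k`) with `k ≥ 3` gives equal
  caterpillar moments (`CaterpillarHom.*`);
* `eval_eq_of_homIndist_of_vanishing`, `polylogHomDetermined_of_vanishing` — every matrix-symmetric
  family vanishing off the distinct-row-sums-and-distinct-column-sums locus is hom-determined below
  treewidth `3`, in particular `PolylogHomDetermined` (unfolded verbatim, exponent `c = 2`);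
* `polylogHomDetermined_discSq_mul` — THE REMARK: for every matrix-symmetric `h`,
  `n ↦ det(V(row sums))² · det(V(col sums))² · h n` (`V` = Vandermonde, `det V ² = Disc²`) is
  `PolylogHomDetermined` (unfolded verbatim), whatever `h` — so for `WidthRung d` with `d ≥ 2n(n-1) + deg h`
  the width hypothesis is idle and `IsVPFamily` must carry the weight (which is why `stub_degreeLifting` is
  conjecture-grade and not a bookkeeping step).

Honest label: calibration of a registered stub's hypothesis; no stub closed; VP ≠ VNP not moved.
-/

-- `Summit.ValiantsHypothesis.ValiantsHypothesis.…` is the tree's mandated namespace (Sub = Summit).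
set_option linter.dupNamespace false

noncomputable section

namespace Summit.ValiantsHypothesis.ValiantsHypothesis.Theorems

namespace WidthSaturation

open Literature.Computability.AlgebraicComplexity MvPolynomial Matrix

/-! ### From hom-indistinguishability to caterpillar moments -/

/-- **`HomIndist n k A B` with `k ≥ 3` gives equal caterpillar moments** (row stars, column stars and
double stars have treewidth `≤ 2`). [folklore] -/
theorem moments_of_homIndist {n k : ℕ} (hk : 3 ≤ k) (A B : Fin n × Fin n → ℂ)
    (hind : ∀ (a b : ℕ) (E : Multiset (Fin a × Fin b)),
      Literature.Combinatorics.SimpleGraph.treewidth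
        (SimpleGraph.fromRel fun u v : Fin a ⊕ Fin b => ∃ p ∈ E, u = Sum.inl p.1 ∧ v = Sum.inr p.2) < k →
      eval A (homPoly E n ℂ) = eval B (homPoly E n ℂ)) :
    (∀ m : ℕ, ∑ u, (∑ j, A (u, j)) ^ m = ∑ u, (∑ j, B (u, j)) ^ m) ∧
    (∀ m : ℕ, ∑ v, (∑ i, A (i, v)) ^ m = ∑ v, (∑ i, B (i, v)) ^ m) ∧
    (∀ m m' : ℕ, ∑ u, ∑ v, (∑ j, A (u, j)) ^ m * A (u, v) * (∑ i, A (i, v)) ^ m' =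
      ∑ u, ∑ v, (∑ j, B (u, j)) ^ m * B (u, v) * (∑ i, B (i, v)) ^ m') := by
  refine ⟨fun m => ?_, fun m => ?_, fun m m' => ?_⟩
  · rw [← CaterpillarHom.eval_homPoly_rowStar m n A, ← CaterpillarHom.eval_homPoly_rowStar m n B]
    exact hind _ _ _ ((CaterpillarHom.treewidth_rowStar_le m).trans_lt (by omega))
  · rw [← CaterpillarHom.eval_homPoly_colStar m n A, ← CaterpillarHom.eval_homPoly_colStar m n B]
    exact hind _ _ _ ((CaterpillarHom.treewidth_colStar_le m).trans_lt (by omega))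
  · rw [← CaterpillarHom.eval_homPoly_doubleStar m m' n A,
      ← CaterpillarHom.eval_homPoly_doubleStar m m' n B]
    exact hind _ _ _ ((CaterpillarHom.treewidth_doubleStar_le m m').trans_lt (by omega))

/-! ### Matrix-symmetric families vanishing off the distinct-sums locus are hom-determined -/

/-- **Hom-determined below treewidth 3.**  A matrix-symmetric family `F` that vanishes at every point
whose row sums are not pairwise distinct or whose column sums are not pairwise distinct takes equal
values at any two points that are hom-indistinguishable below treewidth `k ≥ 3`. [folklore] -/
theorem eval_eq_of_homIndist_of_vanishing (F : (n : ℕ) → MvPolynomial (Fin n × Fin n) ℂ)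
    (hsymm : ∀ (n : ℕ) (σ τ : Equiv.Perm (Fin n)),
      rename (fun p : Fin n × Fin n => (σ p.1, τ p.2)) (F n) = F n)
    (hvan : ∀ (n : ℕ) (A : Fin n × Fin n → ℂ),
      ¬ (Function.Injective (fun u => ∑ j, A (u, j)) ∧ Function.Injective (fun v => ∑ i, A (i, v))) →
      eval A (F n) = 0)
    {n k : ℕ} (hk : 3 ≤ k) (A B : Fin n × Fin n → ℂ)
    (hind : ∀ (a b : ℕ) (E : Multiset (Fin a × Fin b)),
      Literature.Combinatorics.SimpleGraph.treewidth
        (SimpleGraph.fromRel fun u v : Fin a ⊕ Fin b => ∃ p ∈ E, u = Sum.inl p.1 ∧ v = Sum.inr p.2) < k →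
      eval A (homPoly E n ℂ) = eval B (homPoly E n ℂ)) :
    eval A (F n) = eval B (F n) := by
  obtain ⟨hR, hC, hM⟩ := moments_of_homIndist hk A B hind
  by_cases hA : Function.Injective (fun u => ∑ j, A (u, j)) ∧ Function.Injective (fun v => ∑ i, A (i, v))
  · exact MomentAlignment.eval_eq_of_moments_of_matrixSymmetric A B hR hC (fun i j => hM i j) hA.1 hA.2
      (F n) (hsymm n)
  · have hB : ¬ (Function.Injective (fun u => ∑ j, B (u, j)) ∧
        Function.Injective (fun v => ∑ i, B (i, v))) := by
      rintro ⟨hBr, hBc⟩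
      exact hA ⟨MomentAlignment.injective_of_psum_eq (fun m => (hR m).symm) hBr,
        MomentAlignment.injective_of_psum_eq (fun m => (hC m).symm) hBc⟩
    rw [hvan n A hA, hvan n B hB]

/-- **Polylog form** — literally `PolylogHomDetermined F` of line `linear-width` (with `HomIndist` and
`patternGraph` unfolded), exponent `c = 2` (`(log₂ n + 2)² ≥ 4 > 2`). [folklore] -/
theorem polylogHomDetermined_of_vanishing (F : (n : ℕ) → MvPolynomial (Fin n × Fin n) ℂ)
    (hsymm : ∀ (n : ℕ) (σ τ : Equiv.Perm (Fin n)),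
      rename (fun p : Fin n × Fin n => (σ p.1, τ p.2)) (F n) = F n)
    (hvan : ∀ (n : ℕ) (A : Fin n × Fin n → ℂ),
      ¬ (Function.Injective (fun u => ∑ j, A (u, j)) ∧ Function.Injective (fun v => ∑ i, A (i, v))) →
      eval A (F n) = 0) :
    ∃ c : ℕ, ∀ (n : ℕ) (A B : Fin n × Fin n → ℂ),
      (∀ (a b : ℕ) (E : Multiset (Fin a × Fin b)),
        Literature.Combinatorics.SimpleGraph.treewidth
          (SimpleGraph.fromRel fun u v : Fin a ⊕ Fin b => ∃ p ∈ E, u = Sum.inl p.1 ∧ v = Sum.inr p.2) <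
          (Nat.log 2 n + c) ^ c →
        MvPolynomial.eval A (homPoly E n ℂ) = MvPolynomial.eval B (homPoly E n ℂ)) →
      MvPolynomial.eval A (F n) = MvPolynomial.eval B (F n) := by
  refine ⟨2, fun n A B hind => eval_eq_of_homIndist_of_vanishing F hsymm hvan ?_ A B hind⟩
  nlinarith [Nat.zero_le (Nat.log 2 n)]

/-! ### The discriminant prefactors -/

/-- Evaluating the Vandermonde determinant of the row-sum forms gives the Vandermonde determinant of
the row sums. [folklore] -/
theorem eval_det_vandermonde {n : ℕ} (A : Fin n × Fin n → ℂ)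
    (L : Fin n → MvPolynomial (Fin n × Fin n) ℂ) :
    eval A (det (vandermonde L)) = det (vandermonde fun u => eval A (L u)) := by
  rw [RingHom.map_det]
  congr 1
  ext i j
  simp [vandermonde_apply]

/-- Renaming the variables of the Vandermonde determinant of a tuple of polynomials is the Vandermonde
determinant of the renamed tuple. [folklore] -/
theorem rename_det_vandermonde {n : ℕ} (g : Fin n × Fin n → Fin n × Fin n)
    (L : Fin n → MvPolynomial (Fin n × Fin n) ℂ) :
    rename g (det (vandermonde L)) = det (vandermonde fun u => rename g (L u)) := by
  rw [AlgHom.map_det]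
  congr 1
  ext i j
  simp [vandermonde_apply]

/-- The squared Vandermonde determinant is invariant under permuting the tuple. [folklore] -/
theorem det_vandermonde_perm_sq {R : Type*} [CommRing R] {n : ℕ} (v : Fin n → R)
    (σ : Equiv.Perm (Fin n)) :
    det (vandermonde fun u => v (σ u)) ^ 2 = det (vandermonde v) ^ 2 := by
  have : (vandermonde fun u => v (σ u)) = (vandermonde v).submatrix σ id := by
    ext i j; simp [vandermonde_apply]
  rw [this, det_permute, mul_pow]
  rcases Int.units_eq_one_or (Equiv.Perm.sign σ) with h | h <;> simp [h]

/-- **Matrix symmetry of the squared row discriminant** `det(V(row sums))²`. [folklore] -/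
theorem rename_discRowSq {n : ℕ} (σ τ : Equiv.Perm (Fin n)) :
    rename (fun p : Fin n × Fin n => (σ p.1, τ p.2))
      (det (vandermonde fun u : Fin n => ∑ j : Fin n, (X (u, j) : MvPolynomial (Fin n × Fin n) ℂ)) ^ 2) =
      det (vandermonde fun u : Fin n => ∑ j : Fin n, (X (u, j) : MvPolynomial (Fin n × Fin n) ℂ)) ^ 2 := by
  rw [map_pow, rename_det_vandermonde]
  have : (fun u : Fin n => rename (fun p : Fin n × Fin n => (σ p.1, τ p.2))
      (∑ j : Fin n, (X (u, j) : MvPolynomial (Fin n × Fin n) ℂ))) =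
      fun u => (fun w : Fin n => ∑ j : Fin n, (X (w, j) : MvPolynomial (Fin n × Fin n) ℂ)) (σ u) := by
    funext u
    simp only [map_sum, rename_X]
    exact Equiv.sum_comp τ (fun j => (X (σ u, j) : MvPolynomial (Fin n × Fin n) ℂ))
  rw [this]
  exact det_vandermonde_perm_sq (fun w : Fin n => ∑ j : Fin n, (X (w, j) : MvPolynomial (Fin n × Fin n) ℂ)) σ

/-- **Matrix symmetry of the squared column discriminant** `det(V(column sums))²`. [folklore] -/
theorem rename_discColSq {n : ℕ} (σ τ : Equiv.Perm (Fin n)) :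
    rename (fun p : Fin n × Fin n => (σ p.1, τ p.2))
      (det (vandermonde fun v : Fin n => ∑ i : Fin n, (X (i, v) : MvPolynomial (Fin n × Fin n) ℂ)) ^ 2) =
      det (vandermonde fun v : Fin n => ∑ i : Fin n, (X (i, v) : MvPolynomial (Fin n × Fin n) ℂ)) ^ 2 := by
  rw [map_pow, rename_det_vandermonde]
  have : (fun v : Fin n => rename (fun p : Fin n × Fin n => (σ p.1, τ p.2))
      (∑ i : Fin n, (X (i, v) : MvPolynomial (Fin n × Fin n) ℂ))) =
      fun v => (fun w : Fin n => ∑ i : Fin n, (X (i, w) : MvPolynomial (Fin n × Fin n) ℂ)) (τ v) := by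
    funext v
    simp only [map_sum, rename_X]
    exact Equiv.sum_comp σ (fun i => (X (i, τ v) : MvPolynomial (Fin n × Fin n) ℂ))
  rw [this]
  exact det_vandermonde_perm_sq (fun w : Fin n => ∑ i : Fin n, (X (i, w) : MvPolynomial (Fin n × Fin n) ℂ)) τ

/-- The squared row discriminant vanishes exactly where two row sums coincide. [folklore] -/
theorem eval_discRowSq_eq_zero_iff {n : ℕ} (A : Fin n × Fin n → ℂ) :
    eval A (det (vandermonde fun u : Fin n => ∑ j : Fin n, (X (u, j) : MvPolynomial (Fin n × Fin n) ℂ)) ^ 2)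
      = 0 ↔ ¬ Function.Injective (fun u => ∑ j, A (u, j)) := by
  rw [map_pow, eval_det_vandermonde]
  simp only [map_sum, eval_X, ne_eq, pow_eq_zero_iff, OfNat.ofNat_ne_zero, not_false_eq_true]
  rw [← not_iff_not, not_not]
  exact det_vandermonde_ne_zero_iff

/-- The squared column discriminant vanishes exactly where two column sums coincide. [folklore] -/
theorem eval_discColSq_eq_zero_iff {n : ℕ} (A : Fin n × Fin n → ℂ) :
    eval A (det (vandermonde fun v : Fin n => ∑ i : Fin n, (X (i, v) : MvPolynomial (Fin n × Fin n) ℂ)) ^ 2)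
      = 0 ↔ ¬ Function.Injective (fun v => ∑ i, A (i, v)) := by
  rw [map_pow, eval_det_vandermonde]
  simp only [map_sum, eval_X, ne_eq, pow_eq_zero_iff, OfNat.ofNat_ne_zero, not_false_eq_true]
  rw [← not_iff_not, not_not]
  exact det_vandermonde_ne_zero_iff

/-! ### The certified saturation remark -/

/-- **THE SATURATION REMARK of `stub_degreeLifting`, certified.**  For every matrix-symmetric family `h`
over `ℂ`, the family `n ↦ det(V(row sums))² · det(V(column sums))² · h n` — `Disc(row sums)² ·
Disc(column sums)² · h`, of total degree `2 n (n-1) + deg h n` — is `PolylogHomDetermined` (line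
`linear-width`, unfolded verbatim; exponent `c = 2`): its value at a point of `ℂ^{n×n}` is determined by
the values of the homomorphism polynomials of patterns of treewidth `< (log₂ n + 2)²` (indeed `< 3`:
stars and double stars).  No hypothesis on `h` beyond matrix symmetry — in particular no `VP`, degree or
width hypothesis — is used. [folklore] -/
theorem polylogHomDetermined_discSq_mul (h : (n : ℕ) → MvPolynomial (Fin n × Fin n) ℂ)
    (hsymm : ∀ (n : ℕ) (σ τ : Equiv.Perm (Fin n)),
      rename (fun p : Fin n × Fin n => (σ p.1, τ p.2)) (h n) = h n) :
    ∃ c : ℕ, ∀ (n : ℕ) (A B : Fin n × Fin n → ℂ),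
      (∀ (a b : ℕ) (E : Multiset (Fin a × Fin b)),
        Literature.Combinatorics.SimpleGraph.treewidth
          (SimpleGraph.fromRel fun u v : Fin a ⊕ Fin b => ∃ p ∈ E, u = Sum.inl p.1 ∧ v = Sum.inr p.2) <
          (Nat.log 2 n + c) ^ c →
        MvPolynomial.eval A (homPoly E n ℂ) = MvPolynomial.eval B (homPoly E n ℂ)) →
      MvPolynomial.eval A
          (det (vandermonde fun u : Fin n => ∑ j : Fin n, (X (u, j) : MvPolynomial (Fin n × Fin n) ℂ)) ^ 2 *
            det (vandermonde fun v : Fin n => ∑ i : Fin n, (X (i, v) : MvPolynomial (Fin n × Fin n) ℂ)) ^ 2 *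
            h n) =
        MvPolynomial.eval B
          (det (vandermonde fun u : Fin n => ∑ j : Fin n, (X (u, j) : MvPolynomial (Fin n × Fin n) ℂ)) ^ 2 *
            det (vandermonde fun v : Fin n => ∑ i : Fin n, (X (i, v) : MvPolynomial (Fin n × Fin n) ℂ)) ^ 2 *
            h n) := by
  refine polylogHomDetermined_of_vanishing (fun n =>
    det (vandermonde fun u : Fin n => ∑ j : Fin n, (X (u, j) : MvPolynomial (Fin n × Fin n) ℂ)) ^ 2 *
      det (vandermonde fun v : Fin n => ∑ i : Fin n, (X (i, v) : MvPolynomial (Fin n × Fin n) ℂ)) ^ 2 *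
      h n) (fun n σ τ => ?_) (fun n A hA => ?_)
  · simp only [map_mul]
    rw [rename_discRowSq, rename_discColSq, hsymm n σ τ]
  · simp only [map_mul]
    rcases not_and_or.1 hA with h1 | h2
    · rw [(eval_discRowSq_eq_zero_iff A).2 h1, zero_mul, zero_mul]
    · rw [(eval_discColSq_eq_zero_iff A).2 h2, mul_zero, zero_mul]

end WidthSaturation

end Summit.ValiantsHypothesis.ValiantsHypothesis.Theorems

end
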